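import Summits.AtomisticToContinuum.FouriersLaw.Theses.HonestZwanzig

/-!
# `HonestZwanzig.Assembly` — PROVED

Route `AtomisticToContinuum/FouriersLaw/HonestZwanzig` (Honest Zwanzig: Fourier's law as the
Feshbach–Schur complement of the thermostatted Liouvillian on energy profiles), assembly item
`stmt-AtomisticToContinuum-12702` (`Assembly`):

  `NessUnique → OpenChainGreenKubo → GeneratorSiteEnergy → ParityStatics → FeshbachIdentities →
   OrthogonalOhm → PositiveMemory → RobinCoercivity → NetworkReduction → FouriersLaw`.

The route file carries the planner-authored, sorry-free D-0027 §2.1 deciding theorem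
`Summit.AtomisticToContinuum.FouriersLaw.Theses.HonestZwanzig.closes`, whose type is literally the
body of `Assembly`; this file records the item-closing theorem whose type is the route decl
`Assembly` by name.  For the mathematics (`NetworkReduction` turns `GeneratorSiteEnergy`,
`ParityStatics`, `FeshbachIdentities` and the three cruxes `OrthogonalOhm`, `PositiveMemory`,
`RobinCoercivity` into `MemoryConductivity`, i.e. `∫₀^∞ corr(J,J)/(N−1) → k(T) > 0`; clause (i) of
`FouriersLawFor` from the in-tree fact `pinnedChain_exists_isSteadyState` plus `NessUnique`;
`κ T := k(T)/T²`; for a steady-state family `D_N := (∫corr(J,J)/(N−1))/T²` for `N ≥ 2`, whose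
`δ`-limit is `OpenChainGreenKubo` fed `NessUnique`, and `D_N := 0` for `N ≤ 1`, where the chain has
no bond; `D_N → κ T` by `MemoryConductivity / T²`) see the docstring of `closes` in the route file.
No named-fact hypotheses: the theorem is unconditional (its axioms are those of `closes`:
`propext`, `Classical.choice`, `Quot.sound`).
-/

namespace Summit.AtomisticToContinuum.FouriersLaw.Theorems

/-- Settles `stmt-AtomisticToContinuum-12702` (assembly of route `HonestZwanzig`): weak
steady-state uniqueness `NessUnique`, the Kundu–Dhar–Narayan open-chain Green–Kubo identity
`OpenChainGreenKubo`, the structural lemma `GeneratorSiteEnergy` (`L e_x = j_{x−1} − j_x +` bath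
terms), the parity statics `ParityStatics`, the fixed-`N` Feshbach package `FeshbachIdentities`,
the three cruxes `OrthogonalOhm`, `PositiveMemory`, `RobinCoercivity`, and the deterministic
reduction `NetworkReduction` imply the sub-problem statement `FouriersLaw`.  Proof: the route's
deciding theorem `closes` (after unfolding `Assembly`). [folklore] -/
theorem honestZwanzig_assembly_proof :
    Summit.AtomisticToContinuum.FouriersLaw.Theses.HonestZwanzig.Assembly := by
  unfold Summit.AtomisticToContinuum.FouriersLaw.Theses.HonestZwanzig.Assembly
  exact Summit.AtomisticToContinuum.FouriersLaw.Theses.HonestZwanzig.closes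

end Summit.AtomisticToContinuum.FouriersLaw.Theorems
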